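import Literature.Probability.Percolation.QuadCrossingRotationInvariance
import Literature.Probability.RandomPlanarGeometry.RectangleConformalMap
import Literature.Probability.RandomPlanarGeometry.PlanarDomainsTopology
import Literature.Topology.PlaneTopology.Schoenflies
import HarnessLib

/-!
# Square models and perturbations of a conformal rectangle; monotonicity of its crossing event

Topic `Probability/Percolation`; sibling proofs file of `QuadCrossingRotationInvariance.lean`
(the Schramm–Smirnov crossing event `quadCrossing R δ` of a quad `R : ConformalRectangle` — a
Jordan domain with four marked boundary points — by the open edges of `δℤ²`, and the named fact
`dkkmo_crossing_rotation_invariance` = DKKMO, arXiv:2012.11672v1, Cor. 1.3 at `q = 1`).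
Everything here is proved; no named fact is introduced. The companion `QuadCrossingPerturbations.lean`
does the analogous perturbation theory for Schramm–Smirnov's PARAMETRISED quads
`QuadCrossing.Quad D` (homeomorphic images of `[0,1]²`); the present file is the
`ConformalRectangle` side, whose point is the construction of the parametrisation itself
(`exists_isSquareModel`) from the Jordan curve and the four marks, so that the two formalisms can
be bridged (a `ConformalRectangle` with a square model yields a `Quad univ`, next file).

The printed proof of that corollary ("Theorem 1.2 and the measurability of `𝒞(Q)` in the
Schramm–Smirnov topology", §7.1) rests, for the measurability/continuity half, on Schramm–Smirnov's
perturbation argument (O. Schramm, S. Smirnov, Ann. Probab. 39 (2011), proof of Lemma 5.1,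
p. 21 of arXiv:1101.5820): "there is a continuous injective `Q̂₀ : [-1, 2]² → ℂ` whose restriction
to `[0, 1]²` is `Q₀` … For every quadruple `q = (x₀, y₀, x₁, y₁)` define the quad
`Q^q(x, y) := Q̂₀(x₀ + (x₁ - x₀)x, y₀ + (y₁ - y₀)y)`. It is a perturbation of `Q₀`, obtained as an
image of `[x₀, x₁] × [y₀, y₁]` by `Q̂₀`", together with the partial order "`Q₁ ≤ Q₂` if every
crossing of `Q₂` contains a crossing of `Q₁`" (§1.3). This file provides exactly these objects for
the tree's quads (`ConformalRectangle` = Jordan domain with four marked boundary points) and the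
tree's crossing event:

* `rectQuad x₀ x₁ y₀ y₁` — the axis-parallel rectangle as a `ConformalRectangle` (corners marked
  counterclockwise from the bottom-left one; arcs = bottom, right, top, left sides:
  `mem_rectQuad_arc_zero` … `_three`), built from the tree's `rectDomain` (`RectangleConformalMap`);
  `unitSquareQuad` — the model square `(-1, 1)²`.
* `IsSquareModel R Φ` — `Φ : ℂ ≃ₜ ℂ` maps the model square onto `R.carrier` and side `k` onto
  `R.arc k`; **`exists_isSquareModel`: every quad has a square model** (the explicit boundary
  correspondence `SquareModel.bdryMap`, a continuous bijection `∂([-1,1]²) → ∂R` taking side `k`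
  onto arc `k`, extended to the plane by the tree's Schoenflies theorem
  `JordanDomain.exists_homeomorph_eqOn_frontier`, Pommerenke (1992) Cor. 2.9). This is `Q̂₀`,
  defined on all of `ℂ`.
* `perturbQuad Φ x₀ x₁ y₀ y₁ := (rectQuad …).map Φ` — the perturbations `Q^q`; for a square model,
  `perturbQuad Φ (-1) 1 (-1) 1` has the same crossing event as `R`
  (`IsSquareModel.quadCrossing_perturbQuad_eq`).
* **Monotonicity** `quadCrossing_perturbQuad_mono`: if `[x₀', x₁'] ⊆ [x₀, x₁]` and
  `[y₀, y₁] ⊆ [y₀', y₁']` then `𝒞_δ(Φ([x₀', x₁'] × [y₀', y₁'])) ⊆ 𝒞_δ(Φ([x₀, x₁] × [y₀, y₁]))` at every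
  mesh: an open path crossing the narrower-and-taller image quad from its bottom to its top side
  contains, between the last passage of its model height at `y₀` and the first subsequent passage
  at `y₁` (`exists_Icc_passage`), an open crossing of the wider-and-shorter one. Hence
  `𝒞_δ(Q^{q⁺}) ⊆ 𝒞_δ(R) ⊆ 𝒞_δ(Q^{q⁻})` for the inner/outer perturbations
  (`IsSquareModel.quadCrossing_perturbQuad_subset`, `IsSquareModel.subset_quadCrossing_perturbQuad`).

Conventions: the crossing event `quadCrossing R δ` joins `R.arc 0` to `R.arc 2`; in the model these
are the bottom and top sides, so crossings are read vertically (height = imaginary part in the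
model square). Not here: the strict order `Q < Q'` on Schramm–Smirnov's space of parametrised
quads and the continuity estimate (their Lemma 6.1), which are the next steps.

## References

* O. Schramm, S. Smirnov, *On the scaling limits of planar percolation*, Ann. Probab. 39 (2011)
  1768–1814, arXiv:1101.5820: §1.3 (quads, crossings, the order `≤`), §5 proof of Lemma 5.1
  (the extension `Q̂₀` and the perturbations `Q^q`). [SchrammSmirnov2011]
* H. Duminil-Copin, K. K. Kozlowski, D. Krachun, I. Manolescu, M. Oulamara, arXiv:2012.11672v1,
  Cor. 1.3 and §7.1. [DKKMO2020Rotational]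
* Ch. Pommerenke, *Boundary Behaviour of Conformal Maps* (1992), §2.3 Cor. 2.9 (Schoenflies).
-/

noncomputable section

open Set
open Literature.Probability.RandomPlanarGeometry

namespace Literature.Probability.Percolation

/-! ### Arcs of a polygonal marked domain -/

/-- The closed polygon through `l` maps the parameter interval `[k/N, (k+1)/N]` onto the closed
segment from `l[k]` to `l[(k+1) % N]`. [folklore] -/
theorem image_polygonLoop_Icc_div {E : Type*} [AddCommGroup E] [Module ℝ E] {l : List E} {k : ℕ}
    (hk : k < l.length) :
    polygonLoop l '' Icc ((k : ℝ) / l.length) ((k + 1 : ℝ) / l.length) =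
      segment ℝ l[k] (l[(k + 1) % l.length]'(Nat.mod_lt _ (by omega))) := by
  have hN : (0 : ℝ) < l.length := by exact_mod_cast (show 0 < l.length by omega)
  rw [segment_eq_image_lineMap]
  ext z
  simp only [mem_image, mem_Icc]
  constructor
  · rintro ⟨t, ⟨ht0, ht1⟩, rfl⟩
    refine ⟨l.length * t - k, ⟨?_, ?_⟩, ?_⟩
    · rw [div_le_iff₀ hN] at ht0; linarith
    · rw [le_div_iff₀ hN] at ht1; linarith
    · rw [← polygonLoop_apply_div hk]
      · congr 1; field_simp; ring
      · constructor
        · rw [div_le_iff₀ hN] at ht0; linarith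
        · rw [le_div_iff₀ hN] at ht1; linarith
  · rintro ⟨θ, ⟨hθ0, hθ1⟩, rfl⟩
    refine ⟨(k + θ) / l.length, ⟨?_, ?_⟩, polygonLoop_apply_div hk ⟨hθ0, hθ1⟩⟩
    · exact div_le_div_of_nonneg_right (by linarith) hN.le
    · exact div_le_div_of_nonneg_right (by linarith) hN.le

/-! ### The model rectangles -/

/-- The marks `0, 1/4, 1/2, 3/4` of the four corners of a closed polygon with four vertices.
[folklore] -/
def quarterMarks : Fin 4 → ℝ := fun i => (i : ℝ) / 4

/-- `quarterMarks i = i / 4`. [folklore] -/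
@[simp] theorem quarterMarks_apply (i : Fin 4) : quarterMarks i = (i : ℝ) / 4 := rfl

/-- The quarter marks are strictly increasing. [folklore] -/
theorem strictMono_quarterMarks : StrictMono quarterMarks := by
  intro i j hij
  simp only [quarterMarks_apply]
  have : (i : ℝ) < j := by exact_mod_cast hij
  linarith

/-- The quarter marks lie in `[0, 1)`. [folklore] -/
theorem quarterMarks_mem (i : Fin 4) : quarterMarks i ∈ Ico (0 : ℝ) 1 := by
  simp only [quarterMarks_apply, mem_Ico]
  have h0 : (0 : ℝ) ≤ i := by exact_mod_cast Nat.zero_le _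
  have h4 : (i : ℝ) < 4 := by exact_mod_cast i.isLt
  constructor <;> linarith

/-- **The symmetric rectangle `(-a, a) × (-b, b)` as a conformal rectangle**: the Jordan domain
`rectDomain a b` (boundary = the closed polygon through the corners, counterclockwise from the
bottom-left one) with the four corners marked (parameters `0, 1/4, 1/2, 3/4`). Its arcs are the
bottom, right, top and left sides (`symRectQuad_arc`). [folklore] -/
def symRectQuad (a b : ℝ) (ha : 0 < a) (hb : 0 < b) : ConformalRectangle where
  toJordanDomain := rectDomain a b ha hb
  mark := quarterMarks
  strictMono_mark := strictMono_quarterMarks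
  mark_mem := quarterMarks_mem

/-- The carrier of the symmetric model rectangle. [folklore] -/
@[simp] theorem symRectQuad_carrier {a b : ℝ} (ha : 0 < a) (hb : 0 < b) :
    (symRectQuad a b ha hb).carrier = symRect a b := rfl

/-- The corners of the symmetric rectangle, as a function of the index (counterclockwise from
the bottom-left corner, index `4` wrapping to `0`). [folklore] -/
def symRectCorner (a b : ℝ) (k : ℕ) : ℂ :=
  (rectVerts a b)[k % 4]'(by simp only [length_rectVerts]; omega)

/-- The four corners, explicitly. [folklore] -/
theorem symRectCorner_eq (a b : ℝ) :
    symRectCorner a b 0 = ⟨-a, -b⟩ ∧ symRectCorner a b 1 = ⟨a, -b⟩ ∧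
      symRectCorner a b 2 = ⟨a, b⟩ ∧ symRectCorner a b 3 = ⟨-a, b⟩ ∧ symRectCorner a b 4 = ⟨-a, -b⟩ := by
  simp [symRectCorner, rectVerts]

/-- **The arcs of the symmetric model rectangle are its sides**: arc `k` is the closed segment
from corner `k` to corner `k + 1`. [folklore] -/
theorem symRectQuad_arc {a b : ℝ} (ha : 0 < a) (hb : 0 < b) (k : Fin 4) :
    (symRectQuad a b ha hb).arc k = segment ℝ (symRectCorner a b k) (symRectCorner a b (k + 1)) := by
  have hk : (k : ℕ) < (rectVerts a b).length := by simp
  have hmark : (symRectQuad a b ha hb).mark k = (k : ℝ) / (rectVerts a b).length := by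
    simp [symRectQuad]
  have hnext : (symRectQuad a b ha hb).nextMark k = ((k : ℝ) + 1) / (rectVerts a b).length := by
    by_cases h : k.val + 1 < 4
    · rw [MarkedDomain.nextMark_of_lt _ k h]
      simp [symRectQuad]
    · rw [MarkedDomain.nextMark_of_not_lt _ k h]
      have : k.val = 3 := by omega
      simp [symRectQuad, this]; norm_num
  rw [MarkedDomain.arc, hmark, hnext]
  change polygonLoop (rectVerts a b) '' _ = _
  rw [image_polygonLoop_Icc_div hk]
  simp only [symRectCorner, length_rectVerts, Nat.mod_eq_of_lt (show (k : ℕ) < 4 from k.isLt)]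

/-- Membership in a horizontal closed segment of `ℂ`. [folklore] -/
theorem mem_segment_iff_of_im_eq {p q z : ℂ} (hpq : p.re ≤ q.re) (him : p.im = q.im) :
    z ∈ segment ℝ p q ↔ z.im = p.im ∧ z.re ∈ Icc p.re q.re := by
  rw [segment_eq_image_lineMap]
  constructor
  · rintro ⟨θ, ⟨hθ0, hθ1⟩, rfl⟩
    simp only [AffineMap.lineMap_apply_module', Complex.add_im, Complex.smul_im, Complex.sub_im,
      smul_eq_mul, Complex.add_re, Complex.smul_re, Complex.sub_re, mem_Icc]
    refine ⟨by rw [him]; ring, ?_, ?_⟩ <;> nlinarith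
  · rintro ⟨hzi, hz0, hz1⟩
    rcases eq_or_lt_of_le hpq with heq | hlt
    · refine ⟨0, ⟨le_rfl, zero_le_one⟩, ?_⟩
      apply Complex.ext <;> simp [AffineMap.lineMap_apply_module'] <;> [linarith; exact hzi.symm]
    · refine ⟨(z.re - p.re) / (q.re - p.re), ⟨div_nonneg (by linarith) (by linarith),
        (div_le_one (by linarith)).2 (by linarith)⟩, ?_⟩
      apply Complex.ext
      · simp only [AffineMap.lineMap_apply_module', Complex.add_re, Complex.smul_re, Complex.sub_re,
          smul_eq_mul]
        field_simp; ring
      · simp only [AffineMap.lineMap_apply_module', Complex.add_im, Complex.smul_im, Complex.sub_im,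
          smul_eq_mul, him, sub_self, mul_zero, zero_add]
        rw [hzi, him]

/-- Membership in a vertical closed segment of `ℂ`. [folklore] -/
theorem mem_segment_iff_of_re_eq {p q z : ℂ} (hpq : p.im ≤ q.im) (hre : p.re = q.re) :
    z ∈ segment ℝ p q ↔ z.re = p.re ∧ z.im ∈ Icc p.im q.im := by
  rw [segment_eq_image_lineMap]
  constructor
  · rintro ⟨θ, ⟨hθ0, hθ1⟩, rfl⟩
    simp only [AffineMap.lineMap_apply_module', Complex.add_im, Complex.smul_im, Complex.sub_im,
      smul_eq_mul, Complex.add_re, Complex.smul_re, Complex.sub_re, mem_Icc]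
    refine ⟨by rw [hre]; ring, ?_, ?_⟩ <;> nlinarith
  · rintro ⟨hzr, hz0, hz1⟩
    rcases eq_or_lt_of_le hpq with heq | hlt
    · refine ⟨0, ⟨le_rfl, zero_le_one⟩, ?_⟩
      apply Complex.ext <;> simp [AffineMap.lineMap_apply_module'] <;> [exact hzr.symm; linarith]
    · refine ⟨(z.im - p.im) / (q.im - p.im), ⟨div_nonneg (by linarith) (by linarith),
        (div_le_one (by linarith)).2 (by linarith)⟩, ?_⟩
      apply Complex.ext
      · simp only [AffineMap.lineMap_apply_module', Complex.add_re, Complex.smul_re, Complex.sub_re,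
          smul_eq_mul, hre, sub_self, mul_zero, zero_add]
        rw [hzr, hre]
      · simp only [AffineMap.lineMap_apply_module', Complex.add_im, Complex.smul_im, Complex.sub_im,
          smul_eq_mul]
        field_simp; ring

/-- **The axis-parallel rectangle `(x₀, x₁) × (y₀, y₁)` as a conformal rectangle** (the
translate of `symRectQuad`), corners marked counterclockwise from the bottom-left one: arc `0`
is the bottom side, arc `1` the right side, arc `2` the top side, arc `3` the left side. These are
the quads `Q̂₀([x₀, x₁] × [y₀, y₁])` of Schramm–Smirnov's perturbation argument (Ann. Probab. 39
(2011), proof of Lemma 5.1) read in the model square. [folklore] -/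
def rectQuad (x₀ x₁ y₀ y₁ : ℝ) (hx : x₀ < x₁) (hy : y₀ < y₁) : ConformalRectangle :=
  (symRectQuad ((x₁ - x₀) / 2) ((y₁ - y₀) / 2) (by linarith) (by linarith)).map
    (Homeomorph.addRight (⟨(x₀ + x₁) / 2, (y₀ + y₁) / 2⟩ : ℂ))

variable {x₀ x₁ y₀ y₁ : ℝ} (hx : x₀ < x₁) (hy : y₀ < y₁)

/-- Membership in the carrier of the model rectangle. [folklore] -/
theorem mem_rectQuad_carrier {z : ℂ} :
    z ∈ (rectQuad x₀ x₁ y₀ y₁ hx hy).carrier ↔ z.re ∈ Ioo x₀ x₁ ∧ z.im ∈ Ioo y₀ y₁ := by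
  simp only [rectQuad, MarkedDomain.carrier_map, symRectQuad, rectDomain_carrier,
    Homeomorph.coe_addRight, mem_image, mem_symRect, mem_Ioo]
  constructor
  · rintro ⟨w, ⟨⟨h1, h2⟩, h3, h4⟩, rfl⟩
    simp only [Complex.add_re, Complex.add_im]
    refine ⟨⟨?_, ?_⟩, ?_, ?_⟩ <;> linarith
  · rintro ⟨⟨h1, h2⟩, h3, h4⟩
    refine ⟨z - ⟨(x₀ + x₁) / 2, (y₀ + y₁) / 2⟩, ⟨⟨?_, ?_⟩, ?_, ?_⟩, by simp⟩ <;>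
      simp only [Complex.sub_re, Complex.sub_im] <;> linarith

/-- The carrier of the model rectangle is the open rectangle. [folklore] -/
theorem rectQuad_carrier : (rectQuad x₀ x₁ y₀ y₁ hx hy).carrier = Ioo x₀ x₁ ×ℂ Ioo y₀ y₁ := by
  ext z; rw [mem_rectQuad_carrier, Complex.mem_reProdIm]

/-- The closure of the model rectangle is the closed rectangle. [folklore] -/
theorem closure_rectQuad_carrier :
    closure (rectQuad x₀ x₁ y₀ y₁ hx hy).carrier = Icc x₀ x₁ ×ℂ Icc y₀ y₁ := by
  rw [rectQuad_carrier, Complex.closure_reProdIm, closure_Ioo hx.ne, closure_Ioo hy.ne]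

/-- Membership in the closed model rectangle. [folklore] -/
theorem mem_closure_rectQuad_carrier {z : ℂ} :
    z ∈ closure (rectQuad x₀ x₁ y₀ y₁ hx hy).carrier ↔ z.re ∈ Icc x₀ x₁ ∧ z.im ∈ Icc y₀ y₁ := by
  rw [closure_rectQuad_carrier, Complex.mem_reProdIm]

/-- The arcs of the model rectangle are the translated sides. [folklore] -/
theorem rectQuad_arc (k : Fin 4) :
    (rectQuad x₀ x₁ y₀ y₁ hx hy).arc k =
      segment ℝ (symRectCorner ((x₁ - x₀) / 2) ((y₁ - y₀) / 2) k + ⟨(x₀ + x₁) / 2, (y₀ + y₁) / 2⟩)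
        (symRectCorner ((x₁ - x₀) / 2) ((y₁ - y₀) / 2) (k + 1) + ⟨(x₀ + x₁) / 2, (y₀ + y₁) / 2⟩) := by
  rw [rectQuad, MarkedDomain.arc_map, symRectQuad_arc, Homeomorph.coe_addRight]
  set c : ℂ := ⟨(x₀ + x₁) / 2, (y₀ + y₁) / 2⟩
  have e : (fun x : ℂ => x + c) = (fun x => c + x) := by funext x; exact add_comm x c
  rw [e, segment_translate_image, add_comm c, add_comm c]

/-- **Arc `0` of the model rectangle is its bottom side** `[x₀, x₁] × {y₀}`. [folklore] -/
theorem mem_rectQuad_arc_zero {z : ℂ} :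
    z ∈ (rectQuad x₀ x₁ y₀ y₁ hx hy).arc 0 ↔ z.im = y₀ ∧ z.re ∈ Icc x₀ x₁ := by
  rw [rectQuad_arc]
  have e0 : ((0 : Fin 4) : ℕ) = 0 := rfl
  simp only [e0, symRectCorner, rectVerts, List.getElem_cons_zero, List.getElem_cons_succ, zero_add,
    Nat.reduceMod]
  rw [mem_segment_iff_of_im_eq] <;> simp <;> [skip; linarith]
  constructor <;> rintro ⟨h1, h2, h3⟩ <;> refine ⟨by linarith, by linarith, by linarith⟩

/-- **Arc `2` of the model rectangle is its top side** `[x₀, x₁] × {y₁}` (traversed from right to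
left). [folklore] -/
theorem mem_rectQuad_arc_two {z : ℂ} :
    z ∈ (rectQuad x₀ x₁ y₀ y₁ hx hy).arc 2 ↔ z.im = y₁ ∧ z.re ∈ Icc x₀ x₁ := by
  rw [rectQuad_arc, segment_symm]
  have e2 : ((2 : Fin 4) : ℕ) = 2 := rfl
  simp only [e2, symRectCorner, rectVerts, List.getElem_cons_zero, List.getElem_cons_succ,
    Nat.reduceAdd, Nat.reduceMod]
  rw [mem_segment_iff_of_im_eq] <;> simp <;> [skip; linarith]
  constructor <;> rintro ⟨h1, h2, h3⟩ <;> refine ⟨by linarith, by linarith, by linarith⟩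

/-- **Arc `1` of the model rectangle is its right side** `{x₁} × [y₀, y₁]`. [folklore] -/
theorem mem_rectQuad_arc_one {z : ℂ} :
    z ∈ (rectQuad x₀ x₁ y₀ y₁ hx hy).arc 1 ↔ z.re = x₁ ∧ z.im ∈ Icc y₀ y₁ := by
  rw [rectQuad_arc]
  have e1 : ((1 : Fin 4) : ℕ) = 1 := rfl
  simp only [e1, symRectCorner, rectVerts, List.getElem_cons_zero, List.getElem_cons_succ,
    Nat.reduceAdd, Nat.reduceMod]
  rw [mem_segment_iff_of_re_eq] <;> simp <;> [skip; linarith]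
  constructor <;> rintro ⟨h1, h2, h3⟩ <;> refine ⟨by linarith, by linarith, by linarith⟩

/-- **Arc `3` of the model rectangle is its left side** `{x₀} × [y₀, y₁]` (traversed downwards).
[folklore] -/
theorem mem_rectQuad_arc_three {z : ℂ} :
    z ∈ (rectQuad x₀ x₁ y₀ y₁ hx hy).arc 3 ↔ z.re = x₀ ∧ z.im ∈ Icc y₀ y₁ := by
  rw [rectQuad_arc, segment_symm]
  have e3 : ((3 : Fin 4) : ℕ) = 3 := rfl
  simp only [e3, symRectCorner, rectVerts, List.getElem_cons_zero, List.getElem_cons_succ,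
    Nat.reduceAdd, Nat.reduceMod]
  rw [mem_segment_iff_of_re_eq] <;> simp <;> [skip; linarith]
  constructor <;> rintro ⟨h1, h2, h3⟩ <;> refine ⟨by linarith, by linarith, by linarith⟩

/-! ### First passage: a path from below `y₀` to above `y₁` contains a piece inside `[y₀, y₁]` -/

/-- **First-passage decomposition.** A continuous real function on `[a, b]` with `f a ≤ y₀` and
`y₁ ≤ f b` (`y₀ < y₁`) has a sub-interval `[t₀, t₁] ⊆ [a, b]` on which it runs inside
`[y₀, y₁]` from `f t₀ = y₀` to `f t₁ = y₁`: `t₁` is the first passage at level `y₁` and `t₀`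
the last passage at level `y₀` before it. [folklore] -/
theorem exists_Icc_passage {f : ℝ → ℝ} {a b y₀ y₁ : ℝ} (hab : a ≤ b)
    (hf : ContinuousOn f (Icc a b)) (ha : f a ≤ y₀) (hb : y₁ ≤ f b) (hy : y₀ < y₁) :
    ∃ t₀ t₁, a ≤ t₀ ∧ t₀ ≤ t₁ ∧ t₁ ≤ b ∧ f t₀ = y₀ ∧ f t₁ = y₁ ∧
      ∀ t ∈ Icc t₀ t₁, f t ∈ Icc y₀ y₁ := by
  -- first passage at level `y₁`
  set T₁ : Set ℝ := Icc a b ∩ f ⁻¹' Ici y₁ with hT₁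
  have hT₁c : IsClosed T₁ := hf.preimage_isClosed_of_isClosed isClosed_Icc isClosed_Ici
  have hbT₁ : b ∈ T₁ := ⟨right_mem_Icc.2 hab, hb⟩
  have hT₁ne : T₁.Nonempty := ⟨b, hbT₁⟩
  have hT₁bdd : BddBelow T₁ := ⟨a, fun t ht => ht.1.1⟩
  set t₁ := sInf T₁ with ht₁def
  have ht₁mem : t₁ ∈ T₁ := hT₁c.csInf_mem hT₁ne hT₁bdd
  have hat₁ : a ≤ t₁ := ht₁mem.1.1
  have ht₁b : t₁ ≤ b := ht₁mem.1.2
  have hlt₁ : ∀ t ∈ Ico a t₁, f t < y₁ := by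
    intro t ht
    by_contra h
    have htT : t ∈ T₁ := ⟨⟨ht.1, ht.2.le.trans ht₁b⟩, not_lt.1 h⟩
    exact (not_le.2 ht.2) (csInf_le hT₁bdd htT)
  have hft₁ : f t₁ = y₁ := by
    obtain ⟨s, hs, hfs⟩ : ∃ s ∈ Icc a t₁, f s = y₁ :=
      intermediate_value_Icc hat₁ (hf.mono (Icc_subset_Icc_right ht₁b)) ⟨by linarith, ht₁mem.2⟩
    have hsT : s ∈ T₁ := ⟨⟨hs.1, hs.2.trans ht₁b⟩, hfs.ge⟩
    have : t₁ ≤ s := csInf_le hT₁bdd hsT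
    rw [show t₁ = s from le_antisymm this hs.2]; exact hfs
  -- last passage at level `y₀` before `t₁`
  set T₀ : Set ℝ := Icc a t₁ ∩ f ⁻¹' Iic y₀ with hT₀
  have hT₀c : IsClosed T₀ :=
    (hf.mono (Icc_subset_Icc_right ht₁b)).preimage_isClosed_of_isClosed isClosed_Icc isClosed_Iic
  have haT₀ : a ∈ T₀ := ⟨left_mem_Icc.2 hat₁, ha⟩
  have hT₀ne : T₀.Nonempty := ⟨a, haT₀⟩
  have hT₀bdd : BddAbove T₀ := ⟨t₁, fun t ht => ht.1.2⟩
  set t₀ := sSup T₀ with ht₀def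
  have ht₀mem : t₀ ∈ T₀ := hT₀c.csSup_mem hT₀ne hT₀bdd
  have hat₀ : a ≤ t₀ := ht₀mem.1.1
  have ht₀t₁ : t₀ ≤ t₁ := ht₀mem.1.2
  have hgt₀ : ∀ t ∈ Ioc t₀ t₁, y₀ < f t := by
    intro t ht
    by_contra h
    have htT : t ∈ T₀ := ⟨⟨hat₀.trans ht.1.le, ht.2⟩, not_lt.1 h⟩
    exact (not_le.2 ht.1) (le_csSup hT₀bdd htT)
  have hft₀ : f t₀ = y₀ := by
    obtain ⟨s, hs, hfs⟩ : ∃ s ∈ Icc t₀ t₁, f s = y₀ :=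
      intermediate_value_Icc ht₀t₁
        (hf.mono (Icc_subset_Icc hat₀ ht₁b)) ⟨ht₀mem.2, by rw [hft₁]; exact hy.le⟩
    have hsT : s ∈ T₀ := ⟨⟨hat₀.trans hs.1, hs.2⟩, hfs.le⟩
    have : s ≤ t₀ := le_csSup hT₀bdd hsT
    rw [show t₀ = s from le_antisymm hs.1 this]; exact hfs
  refine ⟨t₀, t₁, hat₀, ht₀t₁, ht₁b, hft₀, hft₁, fun t ht => ⟨?_, ?_⟩⟩
  · rcases eq_or_lt_of_le ht.1 with h | h
    · rw [← h, hft₀]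
    · exact (hgt₀ t ⟨h, ht.2⟩).le
  · rcases eq_or_lt_of_le ht.2 with h | h
    · rw [h, hft₁]
    · exact (hlt₁ t ⟨hat₀.trans ht.1, h⟩).le

/-! ### Perturbed quads in a model and monotonicity of the crossing event -/

/-- **The perturbed quad `Φ([x₀, x₁] × [y₀, y₁])`**: the image of the model rectangle under a
homeomorphism `Φ` of the plane (corners and sides transported; arc `0` = `Φ`(bottom side),
arc `2` = `Φ`(top side)). For a square model `Φ` of a quad `Q₀` these are Schramm–Smirnov's
perturbations `Q^q`, `q = (x₀, y₀, x₁, y₁)` (Ann. Probab. 39 (2011), proof of Lemma 5.1: "It is a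
perturbation of `Q₀`, obtained as an image of `[x₀, x₁] × [y₀, y₁]` by `Q̂₀`"). [cite: SchrammSmirnov2011, §5, proof of Lemma 5.1] -/
def perturbQuad (Φ : ℂ ≃ₜ ℂ) (x₀ x₁ y₀ y₁ : ℝ) (hx : x₀ < x₁) (hy : y₀ < y₁) : ConformalRectangle :=
  (rectQuad x₀ x₁ y₀ y₁ hx hy).map Φ

variable (Φ : ℂ ≃ₜ ℂ)

/-- The closed perturbed quad is the image of the closed rectangle. [folklore] -/
theorem closure_perturbQuad_carrier :
    closure (perturbQuad Φ x₀ x₁ y₀ y₁ hx hy).carrier = Φ '' (Icc x₀ x₁ ×ℂ Icc y₀ y₁) := by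
  rw [perturbQuad, MarkedDomain.carrier_map, ← Φ.image_closure, closure_rectQuad_carrier]

/-- Membership in the closed perturbed quad, read in the model. [folklore] -/
theorem mem_closure_perturbQuad_carrier {z : ℂ} :
    z ∈ closure (perturbQuad Φ x₀ x₁ y₀ y₁ hx hy).carrier ↔
      (Φ.symm z).re ∈ Icc x₀ x₁ ∧ (Φ.symm z).im ∈ Icc y₀ y₁ := by
  rw [closure_perturbQuad_carrier, ← Φ.preimage_symm, mem_preimage, Complex.mem_reProdIm]

/-- Arc `0` of the perturbed quad, read in the model: the bottom side. [folklore] -/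
theorem mem_perturbQuad_arc_zero {z : ℂ} :
    z ∈ (perturbQuad Φ x₀ x₁ y₀ y₁ hx hy).arc 0 ↔ (Φ.symm z).im = y₀ ∧ (Φ.symm z).re ∈ Icc x₀ x₁ := by
  rw [perturbQuad, MarkedDomain.arc_map, ← Φ.preimage_symm, mem_preimage, mem_rectQuad_arc_zero]

/-- Arc `2` of the perturbed quad, read in the model: the top side. [folklore] -/
theorem mem_perturbQuad_arc_two {z : ℂ} :
    z ∈ (perturbQuad Φ x₀ x₁ y₀ y₁ hx hy).arc 2 ↔ (Φ.symm z).im = y₁ ∧ (Φ.symm z).re ∈ Icc x₀ x₁ := by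
  rw [perturbQuad, MarkedDomain.arc_map, ← Φ.preimage_symm, mem_preimage, mem_rectQuad_arc_two]

/-- **Monotonicity of the crossing event under perturbation** (Schramm–Smirnov's order
`Q ≤ Q'`: "every crossing of `Q'` contains a crossing of `Q`", Ann. Probab. 39 (2011), §1.3, for
the model perturbations): if `[x₀', x₁'] ⊆ [x₀, x₁]` and `[y₀, y₁] ⊆ [y₀', y₁']`, i.e. the second
rectangle is narrower and taller, then every open crossing of `Φ([x₀', x₁'] × [y₀', y₁'])` from
its bottom to its top side contains an open crossing of `Φ([x₀, x₁] × [y₀, y₁])` (the piece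
between the last passage of the model height at `y₀` and its first passage at `y₁`), so the
crossing event of the former is contained in that of the latter, at every mesh.
[cite: SchrammSmirnov2011, §1.3 (the partial order on quads)] -/
theorem quadCrossing_perturbQuad_mono {x₀' x₁' y₀' y₁' : ℝ} (hx' : x₀' < x₁') (hy' : y₀' < y₁')
    (h₀ : x₀ ≤ x₀') (h₁ : x₁' ≤ x₁) (h₂ : y₀' ≤ y₀) (h₃ : y₁ ≤ y₁') (δ : ℝ) :
    quadCrossing (perturbQuad Φ x₀' x₁' y₀' y₁' hx' hy') δ ⊆
      quadCrossing (perturbQuad Φ x₀ x₁ y₀ y₁ hx hy) δ := by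
  rintro ω ⟨a, ha, b, hb, γ, hγ⟩
  rw [mem_perturbQuad_arc_zero] at ha
  rw [mem_perturbQuad_arc_two] at hb
  -- the model height along the path
  set g : ℝ → ℂ := fun t => Φ.symm (γ.extend t) with hg
  have hgc : Continuous g := Φ.symm.continuous.comp γ.continuous_extend
  set f : ℝ → ℝ := fun t => (g t).im with hf
  have hfc : Continuous f := Complex.continuous_im.comp hgc
  have hf0 : f 0 ≤ y₀ := by simp only [hf, hg, γ.extend_zero, ha.1]; exact h₂
  have hf1 : y₁ ≤ f 1 := by simp only [hf, hg, γ.extend_one, hb.1]; exact h₃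
  obtain ⟨t₀, t₁, h0t₀, ht₀t₁, ht₁1, hft₀, hft₁, hrange⟩ :=
    exists_Icc_passage zero_le_one hfc.continuousOn hf0 hf1 hy
  -- points of the path in `[t₀, t₁]` lie in the smaller closed quad and on open edges
  have hmemF : ∀ t ∈ Icc t₀ t₁, γ.extend t ∈
      closure (perturbQuad Φ x₀ x₁ y₀ y₁ hx hy).carrier ∩ openEdgeUnion δ ω := by
    intro t ht
    have ht01 : t ∈ Icc (0 : ℝ) 1 := ⟨h0t₀.trans ht.1, ht.2.trans ht₁1⟩
    have hγt : γ.extend t ∈ closure (perturbQuad Φ x₀' x₁' y₀' y₁' hx' hy').carrier ∩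
        openEdgeUnion δ ω := by
      rw [γ.extend_apply ht01]; exact hγ _
    have h1 := (mem_closure_perturbQuad_carrier hx' hy' Φ).1 hγt.1
    exact ⟨(mem_closure_perturbQuad_carrier hx hy Φ).2
      ⟨⟨h₀.trans h1.1.1, h1.1.2.trans h₁⟩, hrange t ht⟩, hγt.2⟩
  have hre : ∀ t ∈ Icc t₀ t₁, (Φ.symm (γ.extend t)).re ∈ Icc x₀ x₁ := fun t ht =>
    ((mem_closure_perturbQuad_carrier hx hy Φ).1 (hmemF t ht).1).1
  refine ⟨γ.extend t₀, ?_, γ.extend t₁, ?_, ?_⟩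
  · rw [mem_perturbQuad_arc_zero]
    exact ⟨hft₀, hre t₀ (left_mem_Icc.2 ht₀t₁)⟩
  · rw [mem_perturbQuad_arc_two]
    exact ⟨hft₁, hre t₁ (right_mem_Icc.2 ht₀t₁)⟩
  · have hpc : IsPathConnected (γ.extend '' Icc t₀ t₁) :=
      ((convex_Icc t₀ t₁).isPathConnected ⟨t₀, left_mem_Icc.2 ht₀t₁⟩).image
        γ.continuous_extend
    exact (hpc.joinedIn _ (mem_image_of_mem _ (left_mem_Icc.2 ht₀t₁)) _
      (mem_image_of_mem _ (right_mem_Icc.2 ht₀t₁))).mono (by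
        rintro _ ⟨t, ht, rfl⟩; exact hmemF t ht)

/-! ### The model square `[-1, 1]²` -/

/-- The model square `(-1, 1)²` as a conformal rectangle. [folklore] -/
def unitSquareQuad : ConformalRectangle :=
  rectQuad (-1) 1 (-1) 1 (by norm_num) (by norm_num)

/-- The carrier of the model square. [folklore] -/
theorem unitSquareQuad_carrier : unitSquareQuad.carrier = Ioo (-1) 1 ×ℂ Ioo (-1) 1 :=
  rectQuad_carrier _ _

/-- The frontier of the model square: the four closed sides. [folklore] -/
theorem mem_frontier_unitSquareQuad {p : ℂ} :
    p ∈ frontier unitSquareQuad.carrier ↔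
      ((-1 ≤ p.re ∧ p.re ≤ 1) ∧ (p.im = -1 ∨ p.im = 1)) ∨
        ((p.re = -1 ∨ p.re = 1) ∧ (-1 ≤ p.im ∧ p.im ≤ 1)) := by
  rw [unitSquareQuad_carrier, Complex.frontier_reProdIm, closure_Ioo (by norm_num),
    frontier_Ioo (by norm_num), mem_union, Complex.mem_reProdIm, Complex.mem_reProdIm]
  simp only [mem_Icc, mem_insert_iff, mem_singleton_iff]

namespace SquareModel

variable (R : ConformalRectangle)

/-- `nextMark 0 = mark 1`. [folklore] -/
theorem nextMark_zero : R.nextMark 0 = R.mark 1 := R.nextMark_of_lt 0 (by decide)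
/-- `nextMark 1 = mark 2`. [folklore] -/
theorem nextMark_one : R.nextMark 1 = R.mark 2 := R.nextMark_of_lt 1 (by decide)
/-- `nextMark 2 = mark 3`. [folklore] -/
theorem nextMark_two : R.nextMark 2 = R.mark 3 := R.nextMark_of_lt 2 (by decide)
/-- `nextMark 3 = mark 0 + 1`. [folklore] -/
theorem nextMark_three : R.nextMark 3 = R.mark 0 + 1 := R.nextMark_of_not_lt 3 (by decide)

/-- The marks of a conformal rectangle: `m₀ < m₁ < m₂ < m₃ < m₀ + 1`. [folklore] -/
theorem marks_lt : R.mark 0 < R.mark 1 ∧ R.mark 1 < R.mark 2 ∧ R.mark 2 < R.mark 3 ∧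
    R.mark 3 < R.mark 0 + 1 := by
  refine ⟨R.strictMono_mark (by decide), R.strictMono_mark (by decide),
    R.strictMono_mark (by decide), ?_⟩
  have := (R.mark_mem 3).2; have := (R.mark_mem 0).1; linarith

/-- **The boundary parameter attached to a point of the model square's frontier**: the bottom
side `[-1, 1] × {-1}` is sent affinely onto `[m₀, m₁]`, the right side onto `[m₁, m₂]`, the top
side (right to left) onto `[m₂, m₃]` and the left side (downwards) onto `[m₃, m₀ + 1]`
(`mₖ = R.mark k`), each corner being attributed to the earlier side, so that the values on the
frontier lie in `[m₀, m₀ + 1)`. Junk off the frontier. [folklore] -/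
def param (p : ℂ) : ℝ :=
  if p.im = -1 then R.mark 0 + (p.re + 1) / 2 * (R.mark 1 - R.mark 0)
  else if p.re = 1 then R.mark 1 + (p.im + 1) / 2 * (R.mark 2 - R.mark 1)
  else if p.im = 1 then R.mark 2 + (1 - p.re) / 2 * (R.mark 3 - R.mark 2)
  else R.mark 3 + (1 - p.im) / 2 * (R.mark 0 + 1 - R.mark 3)

/-- The four branches of `param` on the frontier of the model square, with the ranges of the
free coordinate. [folklore] -/
theorem param_cases {p : ℂ} (hp : p ∈ frontier unitSquareQuad.carrier) :
    (p.im = -1 ∧ (-1 ≤ p.re ∧ p.re ≤ 1) ∧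
        param R p = R.mark 0 + (p.re + 1) / 2 * (R.mark 1 - R.mark 0)) ∨
      (p.re = 1 ∧ (-1 < p.im ∧ p.im ≤ 1) ∧
        param R p = R.mark 1 + (p.im + 1) / 2 * (R.mark 2 - R.mark 1)) ∨
      (p.im = 1 ∧ (-1 ≤ p.re ∧ p.re < 1) ∧
        param R p = R.mark 2 + (1 - p.re) / 2 * (R.mark 3 - R.mark 2)) ∨
      (p.re = -1 ∧ (-1 < p.im ∧ p.im < 1) ∧
        param R p = R.mark 3 + (1 - p.im) / 2 * (R.mark 0 + 1 - R.mark 3)) := by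
  rw [mem_frontier_unitSquareQuad] at hp
  unfold param
  by_cases h₁ : p.im = -1
  · refine Or.inl ⟨h₁, ?_, by rw [if_pos h₁]⟩
    rcases hp with ⟨h, -⟩ | ⟨h, -⟩
    · exact h
    · rcases h with h | h <;> rw [h] <;> norm_num
  rw [if_neg h₁]
  by_cases h₂ : p.re = 1
  · refine Or.inr (Or.inl ⟨h₂, ?_, by rw [if_pos h₂]⟩)
    rcases hp with ⟨-, h⟩ | ⟨-, h⟩
    · rcases h with h | h
      · exact absurd h h₁
      · rw [h]; norm_num
    · exact ⟨lt_of_le_of_ne h.1 (Ne.symm h₁), h.2⟩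
  rw [if_neg h₂]
  by_cases h₃ : p.im = 1
  · refine Or.inr (Or.inr (Or.inl ⟨h₃, ?_, by rw [if_pos h₃]⟩))
    rcases hp with ⟨h, -⟩ | ⟨h, -⟩
    · exact ⟨h.1, lt_of_le_of_ne h.2 h₂⟩
    · rcases h with h | h
      · rw [h]; norm_num
      · exact absurd h h₂
  rw [if_neg h₃]
  refine Or.inr (Or.inr (Or.inr ⟨?_, ?_, rfl⟩))
  · rcases hp with ⟨-, h⟩ | ⟨h, -⟩
    · rcases h with h | h
      · exact absurd h h₁
      · exact absurd h h₃
    · rcases h with h | h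
      · exact h
      · exact absurd h h₂
  · rcases hp with ⟨-, h⟩ | ⟨-, h⟩
    · rcases h with h | h
      · exact absurd h h₁
      · exact absurd h h₃
    · exact ⟨lt_of_le_of_ne h.1 (Ne.symm h₁), lt_of_le_of_ne h.2 h₃⟩

/-- **The boundary correspondence** between the model square and the quad `R`: the point of
`∂R` of parameter `param R p`. It maps side `k` of the square onto the arc `R.arc k` and the
corners to the marked points (`image_bdryMap_arc`). [folklore] -/
def bdryMap (p : ℂ) : ℂ := R.boundary (param R p)

/-- The parameter of a frontier point lies in the period `[m₀, m₀ + 1)`. [folklore] -/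
theorem param_mem_Ico {p : ℂ} (hp : p ∈ frontier unitSquareQuad.carrier) :
    param R p ∈ Ico (R.mark 0) (R.mark 0 + 1) := by
  obtain ⟨h01, h12, h23, h3⟩ := marks_lt R
  rcases param_cases R hp with ⟨-, ⟨ha, hb⟩, e⟩ | ⟨-, ⟨ha, hb⟩, e⟩ | ⟨-, ⟨ha, hb⟩, e⟩ |
    ⟨-, ⟨ha, hb⟩, e⟩ <;> rw [e] <;> constructor <;> nlinarith

/-- The boundary parameter is injective on the frontier of the model square: the four branches
have the disjoint ranges `[m₀, m₁]`, `(m₁, m₂]`, `(m₂, m₃]`, `(m₃, m₀ + 1)` and each branch is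
affine in the free coordinate. [folklore] -/
theorem injOn_param : InjOn (param R) (frontier unitSquareQuad.carrier) := by
  obtain ⟨h01, h12, h23, h3⟩ := marks_lt R
  intro p hp q hq hpq
  rcases param_cases R hp with ⟨hp1, ⟨hpa, hpb⟩, ep⟩ | ⟨hp1, ⟨hpa, hpb⟩, ep⟩ |
    ⟨hp1, ⟨hpa, hpb⟩, ep⟩ | ⟨hp1, ⟨hpa, hpb⟩, ep⟩ <;>
  rcases param_cases R hq with ⟨hq1, ⟨hqa, hqb⟩, eq⟩ | ⟨hq1, ⟨hqa, hqb⟩, eq⟩ |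
    ⟨hq1, ⟨hqa, hqb⟩, eq⟩ | ⟨hq1, ⟨hqa, hqb⟩, eq⟩ <;>
  rw [ep, eq] at hpq
  -- 16 cases: equal branches give equal points, distinct branches are impossible
  · apply Complex.ext <;> [nlinarith; rw [hp1, hq1]]
  · exfalso; nlinarith
  · exfalso; nlinarith
  · exfalso; nlinarith
  · exfalso; nlinarith
  · apply Complex.ext <;> [rw [hp1, hq1]; nlinarith]
  · exfalso; nlinarith
  · exfalso; nlinarith
  · exfalso; nlinarith
  · exfalso; nlinarith
  · apply Complex.ext <;> [nlinarith; rw [hp1, hq1]]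
  · exfalso; nlinarith
  · exfalso; nlinarith
  · exfalso; nlinarith
  · exfalso; nlinarith
  · apply Complex.ext <;> [rw [hp1, hq1]; nlinarith]

/-- Every parameter of the period is attained on the frontier of the model square. [folklore] -/
theorem exists_param_eq {s : ℝ} (hs : s ∈ Ico (R.mark 0) (R.mark 0 + 1)) :
    ∃ p ∈ frontier unitSquareQuad.carrier, param R p = s := by
  obtain ⟨h01, h12, h23, h3⟩ := marks_lt R
  obtain ⟨hs0, hs1⟩ := hs
  by_cases ha : s ≤ R.mark 1
  · -- bottom side, `θ = (s - m₀)/(m₁ - m₀) ∈ [0, 1]`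
    set θ := (s - R.mark 0) / (R.mark 1 - R.mark 0) with hθ
    have hθ0 : 0 ≤ θ := div_nonneg (by linarith) (by linarith)
    have hθ1 : θ ≤ 1 := (div_le_one (by linarith)).2 (by linarith)
    have hθs : θ * (R.mark 1 - R.mark 0) = s - R.mark 0 := div_mul_cancel₀ _ (by linarith)
    refine ⟨⟨-1 + 2 * θ, -1⟩, ?_, ?_⟩
    · rw [mem_frontier_unitSquareQuad]
      exact Or.inl ⟨⟨by show (-1 : ℝ) ≤ -1 + 2 * θ; linarith,
        by show (-1 : ℝ) + 2 * θ ≤ 1; linarith⟩, Or.inl rfl⟩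
    · unfold param
      rw [if_pos (show (⟨-1 + 2 * θ, -1⟩ : ℂ).im = -1 from rfl)]
      show R.mark 0 + ((-1 + 2 * θ) + 1) / 2 * (R.mark 1 - R.mark 0) = s
      linear_combination hθs
  by_cases hb : s ≤ R.mark 2
  · -- right side
    have ha' : R.mark 1 < s := lt_of_not_ge ha
    set θ := (s - R.mark 1) / (R.mark 2 - R.mark 1) with hθ
    have hθ0 : 0 < θ := div_pos (by linarith) (by linarith)
    have hθ1 : θ ≤ 1 := (div_le_one (by linarith)).2 (by linarith)
    have hθs : θ * (R.mark 2 - R.mark 1) = s - R.mark 1 := div_mul_cancel₀ _ (by linarith)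
    refine ⟨⟨1, -1 + 2 * θ⟩, ?_, ?_⟩
    · rw [mem_frontier_unitSquareQuad]
      exact Or.inr ⟨Or.inr rfl, by show (-1 : ℝ) ≤ -1 + 2 * θ; linarith,
        by show (-1 : ℝ) + 2 * θ ≤ 1; linarith⟩
    · unfold param
      rw [if_neg (show (⟨1, -1 + 2 * θ⟩ : ℂ).im ≠ -1 from by
          show (-1 : ℝ) + 2 * θ ≠ -1; linarith),
        if_pos (show (⟨1, -1 + 2 * θ⟩ : ℂ).re = 1 from rfl)]
      show R.mark 1 + ((-1 + 2 * θ) + 1) / 2 * (R.mark 2 - R.mark 1) = s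
      linear_combination hθs
  by_cases hc : s ≤ R.mark 3
  · -- top side
    have hb' : R.mark 2 < s := lt_of_not_ge hb
    set θ := (s - R.mark 2) / (R.mark 3 - R.mark 2) with hθ
    have hθ0 : 0 < θ := div_pos (by linarith) (by linarith)
    have hθ1 : θ ≤ 1 := (div_le_one (by linarith)).2 (by linarith)
    have hθs : θ * (R.mark 3 - R.mark 2) = s - R.mark 2 := div_mul_cancel₀ _ (by linarith)
    refine ⟨⟨1 - 2 * θ, 1⟩, ?_, ?_⟩
    · rw [mem_frontier_unitSquareQuad]
      exact Or.inl ⟨⟨by show (-1 : ℝ) ≤ 1 - 2 * θ; linarith,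
        by show (1 : ℝ) - 2 * θ ≤ 1; linarith⟩, Or.inr rfl⟩
    · unfold param
      rw [if_neg (show (⟨1 - 2 * θ, 1⟩ : ℂ).im ≠ -1 from by show (1 : ℝ) ≠ -1; norm_num),
        if_neg (show (⟨1 - 2 * θ, 1⟩ : ℂ).re ≠ 1 from by show (1 : ℝ) - 2 * θ ≠ 1; linarith),
        if_pos (show (⟨1 - 2 * θ, 1⟩ : ℂ).im = 1 from rfl)]
      show R.mark 2 + (1 - (1 - 2 * θ)) / 2 * (R.mark 3 - R.mark 2) = s
      linear_combination hθs
  · -- left side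
    have hc' : R.mark 3 < s := lt_of_not_ge hc
    set θ := (s - R.mark 3) / (R.mark 0 + 1 - R.mark 3) with hθ
    have hθ0 : 0 < θ := div_pos (by linarith) (by linarith)
    have hθ1 : θ < 1 := (div_lt_one (by linarith)).2 (by linarith)
    have hθs : θ * (R.mark 0 + 1 - R.mark 3) = s - R.mark 3 :=
      div_mul_cancel₀ _ (by linarith)
    refine ⟨⟨-1, 1 - 2 * θ⟩, ?_, ?_⟩
    · rw [mem_frontier_unitSquareQuad]
      exact Or.inr ⟨Or.inl rfl, by show (-1 : ℝ) ≤ 1 - 2 * θ; linarith,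
        by show (1 : ℝ) - 2 * θ ≤ 1; linarith⟩
    · unfold param
      rw [if_neg (show (⟨-1, 1 - 2 * θ⟩ : ℂ).im ≠ -1 from by show (1 : ℝ) - 2 * θ ≠ -1; linarith),
        if_neg (show (⟨-1, 1 - 2 * θ⟩ : ℂ).re ≠ 1 from by show (-1 : ℝ) ≠ 1; norm_num),
        if_neg (show (⟨-1, 1 - 2 * θ⟩ : ℂ).im ≠ 1 from by show (1 : ℝ) - 2 * θ ≠ 1; linarith)]
      show R.mark 3 + (1 - (1 - 2 * θ)) / 2 * (R.mark 0 + 1 - R.mark 3) = s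
      linear_combination hθs

/-- The boundary correspondence maps the frontier of the model square bijectively onto the
boundary curve of `R`. [folklore] -/
theorem bijOn_bdryMap :
    BijOn (bdryMap R) (frontier unitSquareQuad.carrier) (frontier R.carrier) := by
  refine ⟨fun p _ => ?_, ?_, ?_⟩
  · rw [← R.range_boundary]; exact mem_range_self _
  · intro p hp q hq hpq
    exact injOn_param R hp hq
      (R.injOn_boundary_Ico_mark_zero (param_mem_Ico R hp) (param_mem_Ico R hq) hpq)
  · intro z hz
    rw [← R.range_boundary] at hz
    obtain ⟨t, rfl⟩ := hz
    obtain ⟨s, hs, hst⟩ := R.periodic_boundary.exists_mem_Ico one_pos t (R.mark 0)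
    obtain ⟨p, hp, hps⟩ := exists_param_eq R hs
    exact ⟨p, hp, by rw [bdryMap, hps, hst]⟩

/-- Arc `0` of the model square: the bottom side. [folklore] -/
theorem mem_arc_zero {p : ℂ} : p ∈ unitSquareQuad.arc 0 ↔ p.im = -1 ∧ p.re ∈ Icc (-1) 1 :=
  mem_rectQuad_arc_zero _ _
/-- Arc `1` of the model square: the right side. [folklore] -/
theorem mem_arc_one {p : ℂ} : p ∈ unitSquareQuad.arc 1 ↔ p.re = 1 ∧ p.im ∈ Icc (-1) 1 :=
  mem_rectQuad_arc_one _ _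
/-- Arc `2` of the model square: the top side. [folklore] -/
theorem mem_arc_two {p : ℂ} : p ∈ unitSquareQuad.arc 2 ↔ p.im = 1 ∧ p.re ∈ Icc (-1) 1 :=
  mem_rectQuad_arc_two _ _
/-- Arc `3` of the model square: the left side. [folklore] -/
theorem mem_arc_three {p : ℂ} : p ∈ unitSquareQuad.arc 3 ↔ p.re = -1 ∧ p.im ∈ Icc (-1) 1 :=
  mem_rectQuad_arc_three _ _

/-- The affine parameter of side `k` of the model square at the point `p`: `(re + 1)/2` on the
bottom, `(im + 1)/2` on the right, `(1 - re)/2` on the top, `(1 - im)/2` on the left side, written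
uniformly as `1/2 + bₖ re + cₖ im`. [folklore] -/
def sideCoord (k : Fin 4) (p : ℂ) : ℝ :=
  1 / 2 + (![1 / 2, 0, -1 / 2, 0] : Fin 4 → ℝ) k * p.re + (![0, 1 / 2, 0, -1 / 2] : Fin 4 → ℝ) k * p.im

/-- Side coordinate of the bottom side. [folklore] -/
@[simp] theorem sideCoord_zero (p : ℂ) : sideCoord 0 p = (p.re + 1) / 2 := by
  simp [sideCoord]; ring
/-- Side coordinate of the right side. [folklore] -/
@[simp] theorem sideCoord_one (p : ℂ) : sideCoord 1 p = (p.im + 1) / 2 := by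
  simp [sideCoord]; ring
/-- Side coordinate of the top side. [folklore] -/
@[simp] theorem sideCoord_two (p : ℂ) : sideCoord 2 p = (1 - p.re) / 2 := by
  simp [sideCoord]; ring
/-- Side coordinate of the left side. [folklore] -/
@[simp] theorem sideCoord_three (p : ℂ) : sideCoord 3 p = (1 - p.im) / 2 := by
  simp [sideCoord]; ring

/-- The side coordinates are continuous. [folklore] -/
theorem continuous_sideCoord (k : Fin 4) : Continuous (sideCoord k) := by
  unfold sideCoord; fun_prop

/-- The continuous branch of the boundary correspondence along side `k`: the point of `∂R` of
parameter `mark k + sideCoord k p · (nextMark k − mark k)`. [folklore] -/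
def sideMap (k : Fin 4) (p : ℂ) : ℂ :=
  R.boundary (R.mark k + sideCoord k p * (R.nextMark k - R.mark k))

/-- Each branch is continuous. [folklore] -/
theorem continuous_sideMap (k : Fin 4) : Continuous (sideMap R k) :=
  R.continuous_boundary.comp (continuous_const.add ((continuous_sideCoord k).mul continuous_const))

/-- On side `k` of the model square the boundary correspondence is the `k`-th branch (at the
corners attributed to the previous side the two parameters differ by the convention only, and at
the bottom-left corner by the period). [folklore] -/
theorem eqOn_bdryMap_sideMap : ∀ k : Fin 4, EqOn (bdryMap R) (sideMap R k) (unitSquareQuad.arc k)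
  | 0 => by
    intro p hp
    rw [mem_arc_zero] at hp
    unfold bdryMap param sideMap
    simp only [sideCoord_zero, if_pos hp.1, nextMark_zero]
  | 1 => by
    intro p hp
    rw [mem_arc_one] at hp
    unfold bdryMap param sideMap
    simp only [sideCoord_one, nextMark_one]
    by_cases h : p.im = -1
    · rw [if_pos h, hp.1, h]; congr 1; ring
    · rw [if_neg h, if_pos hp.1]
  | 2 => by
    intro p hp
    rw [mem_arc_two] at hp
    unfold bdryMap param sideMap
    simp only [sideCoord_two, nextMark_two]
    rw [if_neg (by rw [hp.1]; norm_num)]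
    by_cases h : p.re = 1
    · rw [if_pos h, hp.1, h]; congr 1; ring
    · rw [if_neg h, if_pos hp.1]
  | 3 => by
    intro p hp
    rw [mem_arc_three] at hp
    unfold bdryMap param sideMap
    simp only [sideCoord_three, nextMark_three]
    by_cases h : p.im = -1
    · rw [if_pos h, hp.1, h]
      norm_num
      exact (R.periodic_boundary (R.mark 0)).symm
    · rw [if_neg h, if_neg (by rw [hp.1]; norm_num)]
      by_cases h' : p.im = 1
      · rw [if_pos h', hp.1, h']; congr 1; ring
      · rw [if_neg h']

/-- The boundary correspondence is continuous on the frontier of the model square (pasting the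
four continuous branches along the closed sides). [folklore] -/
theorem continuousOn_bdryMap : ContinuousOn (bdryMap R) (frontier unitSquareQuad.carrier) := by
  rw [← (unitSquareQuad.iUnion_arc_holds : ⋃ i, unitSquareQuad.arc i = frontier unitSquareQuad.carrier)]
  exact LocallyFinite.continuousOn_iUnion (locallyFinite_of_finite _)
    (fun k => unitSquareQuad.isClosed_arc k)
    fun k => ((continuous_sideMap R k).continuousOn).congr (eqOn_bdryMap_sideMap R k)

/-- The point of side `k` of the model square with side coordinate `θ`:
`(-1 + 2θ, -1)`, `(1, -1 + 2θ)`, `(1 - 2θ, 1)`, `(-1, 1 - 2θ)`. [folklore] -/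
def sidePoint (k : Fin 4) (θ : ℝ) : ℂ :=
  ⟨(![-1, 1, 1, -1] : Fin 4 → ℝ) k + (![2, 0, -2, 0] : Fin 4 → ℝ) k * θ,
    (![-1, -1, 1, 1] : Fin 4 → ℝ) k + (![0, 2, 0, -2] : Fin 4 → ℝ) k * θ⟩

/-- The point of side coordinate `θ ∈ [0, 1]` lies on side `k` and has side coordinate `θ`.
[folklore] -/
theorem sidePoint_mem {θ : ℝ} (hθ : θ ∈ Icc (0 : ℝ) 1) :
    ∀ k : Fin 4, sidePoint k θ ∈ unitSquareQuad.arc k ∧ sideCoord k (sidePoint k θ) = θ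
  | 0 => by
    obtain ⟨h0, h1⟩ := hθ
    refine ⟨mem_arc_zero.2 ⟨by simp [sidePoint], ?_, ?_⟩, by simp [sidePoint]⟩
    · show (-1 : ℝ) ≤ -1 + 2 * θ; linarith
    · show (-1 : ℝ) + 2 * θ ≤ 1; linarith
  | 1 => by
    obtain ⟨h0, h1⟩ := hθ
    refine ⟨mem_arc_one.2 ⟨by simp [sidePoint], ?_, ?_⟩, by simp [sidePoint]⟩
    · show (-1 : ℝ) ≤ -1 + 2 * θ; linarith
    · show (-1 : ℝ) + 2 * θ ≤ 1; linarith
  | 2 => by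
    obtain ⟨h0, h1⟩ := hθ
    refine ⟨mem_arc_two.2 ⟨by simp [sidePoint], ?_, ?_⟩, by simp [sidePoint]⟩
    · show (-1 : ℝ) ≤ 1 + -2 * θ; linarith
    · show (1 : ℝ) + -2 * θ ≤ 1; linarith
  | 3 => by
    obtain ⟨h0, h1⟩ := hθ
    refine ⟨mem_arc_three.2 ⟨by simp [sidePoint], ?_, ?_⟩, by simp [sidePoint]⟩
    · show (-1 : ℝ) ≤ 1 + -2 * θ; linarith
    · show (1 : ℝ) + -2 * θ ≤ 1; linarith

/-- On side `k` the side coordinate lies in `[0, 1]`. [folklore] -/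
theorem sideCoord_mem {p : ℂ} : ∀ {k : Fin 4}, p ∈ unitSquareQuad.arc k → sideCoord k p ∈ Icc (0 : ℝ) 1
  | 0, hp => by
    obtain ⟨-, h0, h1⟩ := mem_arc_zero.1 hp
    rw [sideCoord_zero]; constructor <;> linarith
  | 1, hp => by
    obtain ⟨-, h0, h1⟩ := mem_arc_one.1 hp
    rw [sideCoord_one]; constructor <;> linarith
  | 2, hp => by
    obtain ⟨-, h0, h1⟩ := mem_arc_two.1 hp
    rw [sideCoord_two]; constructor <;> linarith
  | 3, hp => by
    obtain ⟨-, h0, h1⟩ := mem_arc_three.1 hp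
    rw [sideCoord_three]; constructor <;> linarith

/-- **The boundary correspondence maps side `k` of the model square onto the arc `R.arc k`.**
[folklore] -/
theorem image_bdryMap_arc (k : Fin 4) : bdryMap R '' unitSquareQuad.arc k = R.arc k := by
  rw [(eqOn_bdryMap_sideMap R k).image_eq]
  have hΔ : 0 < R.nextMark k - R.mark k := sub_pos.2 (R.mark_lt_nextMark k)
  apply Subset.antisymm
  · rintro _ ⟨p, hp, rfl⟩
    obtain ⟨h0, h1⟩ := sideCoord_mem hp
    refine ⟨R.mark k + sideCoord k p * (R.nextMark k - R.mark k), ⟨?_, ?_⟩, rfl⟩ <;> nlinarith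
  · rintro _ ⟨t, ⟨ht0, ht1⟩, rfl⟩
    set θ := (t - R.mark k) / (R.nextMark k - R.mark k) with hθ
    have hθmem : θ ∈ Icc (0 : ℝ) 1 :=
      ⟨div_nonneg (by linarith) hΔ.le, (div_le_one hΔ).2 (by linarith)⟩
    have hθt : θ * (R.nextMark k - R.mark k) = t - R.mark k := div_mul_cancel₀ _ hΔ.ne'
    obtain ⟨hmem, hcoord⟩ := sidePoint_mem hθmem k
    refine ⟨sidePoint k θ, hmem, ?_⟩
    rw [sideMap, hcoord]
    congr 1
    linear_combination hθt

end SquareModel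

/-! ### Square models of a quad -/

/-- **`Φ` is a square model of the quad `R`**: a homeomorphism of the plane mapping the open model
square `(-1, 1)²` onto the Jordan domain of `R` and each side `k` of the square onto the boundary
arc `R.arc k` (so corners go to marked points; this is Schramm–Smirnov's "continuous injective
`Q̂₀ : [-1, 2]² → ℂ` whose restriction to `[0,1]²` is `Q₀`", Ann. Probab. 39 (2011), proof of
Lemma 5.1, here defined on the whole plane). [cite: SchrammSmirnov2011, §5, proof of Lemma 5.1] -/
structure IsSquareModel (R : ConformalRectangle) (Φ : ℂ ≃ₜ ℂ) : Prop where
  /-- The open square goes onto the domain. -/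
  image_carrier : Φ '' unitSquareQuad.carrier = R.carrier
  /-- Side `k` goes onto the arc `R.arc k`. -/
  image_arc : ∀ k : Fin 4, Φ '' unitSquareQuad.arc k = R.arc k

/-- **Every quad has a square model** (Schoenflies: the boundary correspondence `bdryMap R`, a
continuous bijection of the frontier of the model square onto `∂R` sending side `k` onto
`R.arc k`, extends to a homeomorphism of `ℂ` mapping the square onto the domain —
`JordanDomain.exists_homeomorph_eqOn_frontier`, Pommerenke (1992), Cor. 2.9). Schramm–Smirnov
("It is easy to see (e.g., using the Riemann map onto `ℂ̂ ∖ [Q₀]`) that there is a continuous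
injective `Q̂₀ : [-1, 2]² → ℂ` whose restriction to `[0, 1]²` is `Q₀`") use it to perturb quads.
[cite: SchrammSmirnov2011, §5, proof of Lemma 5.1] -/
theorem exists_isSquareModel (R : ConformalRectangle) : ∃ Φ : ℂ ≃ₜ ℂ, IsSquareModel R Φ := by
  obtain ⟨Φ, hΦ, hcar, -, -⟩ := unitSquareQuad.toJordanDomain.exists_homeomorph_eqOn_frontier
    R.toJordanDomain (SquareModel.continuousOn_bdryMap R) (SquareModel.bijOn_bdryMap R)
  refine ⟨Φ, hcar, fun k => ?_⟩
  rw [(hΦ.mono (unitSquareQuad.arc_subset_frontier k)).image_eq]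
  exact SquareModel.image_bdryMap_arc R k

namespace IsSquareModel

variable {R : ConformalRectangle} {Φ : ℂ ≃ₜ ℂ} (h : IsSquareModel R Φ)
include h

/-- A square model maps the closed square onto the closed quad. [folklore] -/
theorem image_closure : Φ '' closure unitSquareQuad.carrier = closure R.carrier := by
  rw [Φ.image_closure, h.image_carrier]

/-- A square model maps the closed square `[-1, 1]²` onto the closed quad. [folklore] -/
theorem image_Icc : Φ '' (Icc (-1) 1 ×ℂ Icc (-1) 1) = closure R.carrier := by
  rw [← h.image_closure, unitSquareQuad_carrier, Complex.closure_reProdIm,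
    closure_Ioo (by norm_num)]

/-- A square model maps the corners of the square to the marked points. [folklore] -/
theorem image_frontier : Φ '' frontier unitSquareQuad.carrier = frontier R.carrier := by
  rw [Φ.image_frontier, h.image_carrier]

end IsSquareModel



/-! ### Crossing events of a quad and of its perturbations -/

/-- The crossing event depends only on the closed quad and its two distinguished arcs. [folklore] -/
theorem quadCrossing_congr {R R' : ConformalRectangle} (hc : closure R.carrier = closure R'.carrier)
    (h0 : R.arc 0 = R'.arc 0) (h2 : R.arc 2 = R'.arc 2) (δ : ℝ) :
    quadCrossing R δ = quadCrossing R' δ := by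
  ext ω
  simp only [mem_quadCrossing_iff, hc, h0, h2]

namespace IsSquareModel

variable {R : ConformalRectangle} {Φ : ℂ ≃ₜ ℂ} (h : IsSquareModel R Φ)
include h

/-- **In a square model the unperturbed image quad has the crossing event of `R`**:
`𝒞_δ(Φ([-1, 1]²)) = 𝒞_δ(R)` (same closed quad, same arcs `0` and `2`). [folklore] -/
theorem quadCrossing_perturbQuad_eq (δ : ℝ) :
    quadCrossing (perturbQuad Φ (-1) 1 (-1) 1 (by norm_num) (by norm_num)) δ = quadCrossing R δ := by
  refine quadCrossing_congr ?_ ?_ ?_ δ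
  · rw [perturbQuad, MarkedDomain.carrier_map, ← Φ.image_closure]
    exact h.image_closure
  · rw [perturbQuad, MarkedDomain.arc_map]; exact h.image_arc 0
  · rw [perturbQuad, MarkedDomain.arc_map]; exact h.image_arc 2

/-- **Inner perturbations are harder**: for `-1 ≤ x₀ < x₁ ≤ 1` and `y₀ ≤ -1`, `1 ≤ y₁` (narrower
and taller than the model square), `𝒞_δ(Φ([x₀, x₁] × [y₀, y₁])) ⊆ 𝒞_δ(R)` — Schramm–Smirnov's
`Q₀ ≤ Q^q`. [cite: SchrammSmirnov2011, §1.3 (the partial order on quads)] -/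
theorem quadCrossing_perturbQuad_subset {x₀ x₁ y₀ y₁ : ℝ} (hx : x₀ < x₁) (hy : y₀ < y₁)
    (h₀ : -1 ≤ x₀) (h₁ : x₁ ≤ 1) (h₂ : y₀ ≤ -1) (h₃ : 1 ≤ y₁) (δ : ℝ) :
    quadCrossing (perturbQuad Φ x₀ x₁ y₀ y₁ hx hy) δ ⊆ quadCrossing R δ := by
  rw [← h.quadCrossing_perturbQuad_eq δ]
  exact quadCrossing_perturbQuad_mono (by norm_num) (by norm_num) Φ hx hy h₀ h₁ h₂ h₃ δ

/-- **Outer perturbations are easier**: for `x₀ ≤ -1`, `1 ≤ x₁` and `-1 ≤ y₀ < y₁ ≤ 1` (wider and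
shorter than the model square), `𝒞_δ(R) ⊆ 𝒞_δ(Φ([x₀, x₁] × [y₀, y₁]))` — Schramm–Smirnov's
`Q^q ≤ Q₀`. [cite: SchrammSmirnov2011, §1.3 (the partial order on quads)] -/
theorem subset_quadCrossing_perturbQuad {x₀ x₁ y₀ y₁ : ℝ} (hx : x₀ < x₁) (hy : y₀ < y₁)
    (h₀ : x₀ ≤ -1) (h₁ : 1 ≤ x₁) (h₂ : -1 ≤ y₀) (h₃ : y₁ ≤ 1) (δ : ℝ) :
    quadCrossing R δ ⊆ quadCrossing (perturbQuad Φ x₀ x₁ y₀ y₁ hx hy) δ := by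
  rw [← h.quadCrossing_perturbQuad_eq δ]
  exact quadCrossing_perturbQuad_mono hx hy Φ (by norm_num) (by norm_num) h₀ h₁ h₂ h₃ δ

end IsSquareModel

end Literature.Probability.Percolation
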